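import Summits.QuantumFields.YangMills.Theorems.BalabanUVNodesK0S5MeetFamilyJunction
import HarnessLib

/-!
# K0⁷ `stub_prop8StepCoP13` (stmt-QuantumFields-20541), sub-target S5 — **THE UNIFORM-DATUM DOOR AT ANY ADMISSIBLE FAMILY AND AT PRINT's (150) FAMILY**: the third summand
# `HD(A₁ + HB) = H_V 𝔇(A′)` of [Balaban1985Variational] (159) (and any `H`-applied datum with ONE size) needs the `H`-letters for a datum `‖B c‖ ≤ s` on EVERY cell; dag-n07-w4's
# `letters10On_H_uniform_cubeDomains_box` (p605564, v1.1) gives them at the plain cube tower `cubeDomains`; at a boundary datum the family is the meet `D″ = cubeDomains ⊓ domainsOfSeq Ω`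
# (n07-e 44B∕44C, this seat's Q-CUBE-TOP), so this file re-derives the door from the NEAR-CLASS socket (p613700 §4) with the near class «every cell» — no far cells, no collar, the far
# coefficient `θ := 8CB₃` at `R′ := 0` — for ANY `Adm22` family and window, and instantiates it at `D″` with FILE 6's `hY`

Cell `pub-ymgap`, width seat `pub-ymgap-k0-s1-w3` gen 5 (HUMAN RULING D-0149; START LIST v11 §k0-s1; bus CLAIM-7 of g5).  `--kind proof --supports stmt-QuantumFields-20541 --as helper`;
count-neutral; def-free; compositions BY NAME (p613700 `letters10On_HB_of_core_adm22_T4_nearClassW`, p619350 `meet_cube_domainsOfSeq_k` ∕ `inOm_top_meet_of_mem_box`, ym3-torus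
`HalvingQuarterCubeSeq.distBI_nonneg`); dag-n07-w4's v1.1 door is the instance `D := cubeDomains`, `θ` free (kept; interior datums use it).

WHAT IS PROVED (sorry-free; axioms standard; no definition).
§1 ★★ `letters10On_H_uniform_of_core_adm22_T4 (F N)` — for every `Adm22` family `D` of height `K − n` on NODE 00's torus, every window `Y` over `Ω_{K−n}`, every componentwise extension `H_V` of
   `flatH`, and every datum with `‖B c‖ ≤ s` on ALL cells (`0 ≤ s`): `Letters10On Y η_{K−n} t (H_V B)` for every `t > 2·C·B₃·s` (p613700 §4 at `near := ⊤`, `C_d := 1`, `M_Δ := 1`, `ε₁ := s`,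
   `ε ≡ s`, `R′ := 0`, `θ := 8CB₃`: `¼·max{4CB₃s, 8CB₃s} = 2CB₃s`; the near shape `s·L^{k−j}·(distBI + 1) ≥ s` since `L ≥ 1`, `distBI ≥ 0`).
§2 ★★ `letters10On_H_uniform_meetCube_box (F N)` — the same at `D″ := domainsMeet (cubeDomains (F.P K) a M ρ (K − n) hk) (domainsOfSeq Ω (K − n) hk)` with the window `π '' box L a M (K − n)`
   (non-wrapping tower, `Ω` decreasing + saturated, `π(□) ⊆ Ω_{K−n}` — FILE 6 `inOm_top_meet_of_mem_box`), `Adm22 D″ R (L·M_h)` a hypothesis (dag-n07-w6 INTENT-9).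
HONEST SCOPE: compositions by name; the uniform size `s` of the datum `𝔇(A′)` (P3a ∕ (157), `O(ρ₀²)`), `Adm22 D″`, the placement and the kernel formula are the consumer's; nothing of
[15]∕[6]∕[B6-II] asserted; `stub_prop8StepCoP13` ∕ K0⁷ NOT closed; N07 NOT discharged (5∕27 unmoved); one finite 𝕋⁴ programme at fixed ε — R4 closes the conditional finite-𝕋⁴ rung
`BalabanLadder.UV` ONLY; the YM mass gap (Clay) is NOT proved by any of this; nothing continuum ∕ ℝ⁴ ∕ OS.  No `def`, no `instance`, no `notation`, no `sorry`.

References: T. Bałaban, CMP **102** (1985) 277–309 [Balaban1985Variational] (150) p.301, (157) p.302, (159) p.303, (164)–(165) p.304; CMP **96** (1984) 223–250 [Balaban1984PropagatorsII]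
(2.1)–(2.2) p.224, Cor. 2.8 p.249.
-/

set_option autoImplicit false

noncomputable section

open scoped BigOperators Matrix.Norms.L2Operator

namespace Summit.QuantumFields.YangMills.Theorems.K0S5UniformDatumDoor

open Literature.MathematicalPhysics.QuantumFieldTheory.Balaban1983to89
open Literature.MathematicalPhysics.QuantumFieldTheory.Balaban1983to89.Node00
open B15Eq112TorusCover (cover)
open B14DomainGeom (Pt)
open B5Eq118OneStroke (iterBlockOf)
open B6SectADomainsV1 (Domains)
open B6SectAOperatorsV1 (BondIdx)
open B8Eq131Cubes (box cube)
open T4Continuum (T4Family)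
open Summit.QuantumFields.YangMills.Theorems.FlatCubeOpsText (Adm22 distBI)
open Summit.QuantumFields.YangMills.Theorems.K0FlatCubeOpsTextP (IsLevWeight flatH)
open Summit.QuantumFields.YangMills.Theorems.HalvingQuarterCubeSeq (distBI_nonneg)
open Summit.QuantumFields.YangMills.Theorems.K0S5FarCollarLetters (letters10On_HB_of_core_adm22_T4_nearClassW)
open Summit.QuantumFields.YangMills.Theorems.K0S5MeetFamilyJunction (meet_cube_domainsOfSeq_k inOm_top_meet_of_mem_box)
open Summit.QuantumFields.YangMills.BalabanUVNodes.N07HalvingStepTopOfLocalLetters (Letters10On)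

/-! ## §1  One size on every cell: the near class is everything, no collar, `θ := 8CB₃` -/

open scoped Classical in
/-- ★★ **THE `H`-LETTERS FOR A DATUM OF UNIFORM SIZE, ANY ADMISSIBLE FAMILY, ANY WINDOW** (the door for `HD(A₁ + HB) = H_V 𝔇(A′)`): for `D : Domains (F.P K)` with `D.k = K − n` and
`Adm22 D R (L·M_h)`, a window `Y` over `Ω_{K−n}`, level weights at `D`, a componentwise extension `H_V` of `flatH`, and a datum with `‖B c‖ ≤ s` on every cell (`0 ≤ s`):
`Letters10On Y η_{K−n} t (H_V B)` for every `t > 2·C·B₃·s`. [cite: Balaban1985Variational, (157) p.302, (159) p.303, (164)–(165) p.304; Balaban1984PropagatorsII, Cor. 2.8 (2.150)–(2.151) p.249] -/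
theorem letters10On_H_uniform_of_core_adm22_T4 (F : T4Family) (N : ℕ) [NeZero N] :
    ∃ (Mh₀ R₀ : ℕ) (C δ₀ δ₁ B₃ : ℝ), 0 ≤ C ∧ 0 < δ₀ ∧ 0 < δ₁ ∧ 0 < B₃ ∧
    ∀ (n K : ℕ) (_ : 1 ≤ K - n) (_ : K - n + 1 ≤ F.m + K) {Mh R a' : ℕ} (_ : Mh = F.L ^ a') (_ : Mh₀ ≤ Mh) (_ : R₀ ≤ R) (_ : a' + 3 ≤ F.m + n)
      (D : Domains (F.P K)) (_ : D.k = K - n) (_ : Adm22 D R (F.L * Mh))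
      (w : ℕ → PBond (F.P K) 0 → ℝ) (_ : IsLevWeight (F.P K) (K - n) D w)
      {Y : Set (Site (F.P K) 0)} (_ : ∀ x ∈ Y, D.InOm (K - n) x)
      {HV : (BondIdx D → MatA N) →ₗ[ℂ] (PBond (F.P K) 0 → MatA N)}
      (_ : ∀ (A : BondIdx D → MatA N) (b : PBond (F.P K) 0), HV A b = ∑ c, ((flatH (F.P K) (K - n) D (Pi.single c 1) b : ℝ) : ℂ) • A c)
      {B : BondIdx D → MatA N} {s : ℝ} (_ : 0 ≤ s) (_ : ∀ c, ‖B c‖ ≤ s)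
      {t : ℝ} (_ : 2 * C * B₃ * s < t),
      Letters10On Y ((F.P K).eta (K - n)) t (HV B) := by
  obtain ⟨Mh₀, R₀, C, δ₀, δ₁, B₃, hC, hδ₀, hδ₁, hB₃, hmain⟩ := letters10On_HB_of_core_adm22_T4_nearClassW F N
  refine ⟨Mh₀, R₀, C, δ₀, δ₁, B₃, hC, hδ₀, hδ₁, hB₃, ?_⟩
  intro n K hk1 hk' Mh R a' hMha hMh hR hsize D hDk hAdm w hw Y hY HV hHv B s hs hB t ht
  have hL1 : (1 : ℝ) ≤ ((F.P K).L : ℝ) := by exact_mod_cast (F.P K).L_pos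
  -- the (163)-row at `R′ := 0` with `θ := 8CB₃`; the threshold `¼·max{4CB₃s, 8CB₃s} = 2CB₃s`
  have h163 : 8 * (1 : ℝ) * C * B₃ * Real.exp (-(δ₁ * 0)) ≤ 8 * C * B₃ := by simp
  have hmax : 1 / 4 * (1 : ℝ) * max (4 * 1 * C * B₃ * s) (8 * C * B₃ * s) < t := by
    have hCB : 0 ≤ C * B₃ * s := by positivity
    rw [max_eq_right (by nlinarith)]
    linarith
  refine hmain n K hk1 hk' hMha hMh hR hsize D hDk hAdm w hw (Cd := 1) (MΔ := 1) (ε₁ := s) (θ := 8 * C * B₃) (R' := 0) (ε := fun _ => s)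
    zero_le_one zero_le_one hs hs (fun _ _ => by linarith) h163 (fun _ => True) hY (fun b _ c hc => absurd trivial hc) hHv
    (fun b _ c _ => ?_) (fun b _ c hc => absurd trivial hc) hmax
  -- the near shape: `s ≤ s·L^{k−j}·(distBI + 1)`
  have hd := distBI_nonneg D b c
  have hpow : (1 : ℝ) ≤ ((F.P K).L : ℝ) ^ ((K - n) - (c.1.1 : ℕ)) := one_le_pow₀ hL1
  calc ‖B c‖ ≤ s := hB c
    _ = s * 1 * 1 := by ring
    _ ≤ s * ((F.P K).L : ℝ) ^ ((K - n) - (c.1.1 : ℕ)) * (distBI D b c + 1) :=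
        mul_le_mul (mul_le_mul_of_nonneg_left hpow hs) (by linarith) zero_le_one (by positivity)
    _ = 1 * 1 * s * ((F.P K).L : ℝ) ^ ((K - n) - (c.1.1 : ℕ)) * (distBI D b c + 1) := by ring

/-! ## §2  At print's (150) family: the meet `cubeDomains ⊓ domainsOfSeq Ω` with the grid cube's window -/

open scoped Classical in
/-- ★★ **THE UNIFORM-DATUM DOOR AT A BOUNDARY DATUM** — §1 at `D″ := domainsMeet (cubeDomains (F.P K) a M ρ (K − n) hk) (domainsOfSeq Ω (K − n) hk)` with the window `π '' box L a M (K − n)`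
(`hY` by p619350 `inOm_top_meet_of_mem_box`: non-wrapping tower, `1 ≤ K − n`, `Ω` decreasing + saturated, `π(□) ⊆ Ω_{K−n}`), `Adm22 D″ R (L·M_h)` a hypothesis: for `‖B c‖ ≤ s` on every cell,
`Letters10On (π '' □) η_{K−n} t (H_V B)` for every `t > 2·C·B₃·s`. [cite: Balaban1985Variational, (150) p.301, (157) p.302, (159) p.303, (164)–(165) p.304] -/
theorem letters10On_H_uniform_meetCube_box (F : T4Family) (N : ℕ) [NeZero N] :
    ∃ (Mh₀ R₀ : ℕ) (C δ₀ δ₁ B₃ : ℝ), 0 ≤ C ∧ 0 < δ₀ ∧ 0 < δ₁ ∧ 0 < B₃ ∧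
    ∀ (n K : ℕ) (hk1 : 1 ≤ K - n) (_ : K - n + 1 ≤ F.m + K) (hk : K - n ≤ (F.P K).m + (F.P K).K)
      {Mh R a' : ℕ} (_ : Mh = F.L ^ a') (_ : Mh₀ ≤ Mh) (_ : R₀ ≤ R) (_ : a' + 3 ≤ F.m + n)
      {a : Pt (F.P K).d} {M ρ : ℕ} (_ : Set.InjOn (cover (F.P K)) (cube (F.P K).L a M ρ (K - n) 0))
      (Ω : ℕ → Set (Site (F.P K) 0)) (_ : ∀ i : ℕ, 1 ≤ i → i < K - n → Ω (i + 1) ⊆ Ω i)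
      (_ : ∀ (j : ℕ) (x x' : Site (F.P K) 0), 1 ≤ j → j ≤ K - n → iterBlockOf j x = iterBlockOf j x' → x ∈ Ω j → x' ∈ Ω j)
      (_ : ∀ x ∈ box (F.P K).L a M (K - n), cover (F.P K) x ∈ Ω (K - n))
      (_ : Adm22 (domainsMeet (cubeDomains (F.P K) a M ρ (K - n) hk) (domainsOfSeq Ω (K - n) hk)) R (F.L * Mh))
      (w : ℕ → PBond (F.P K) 0 → ℝ) (_ : IsLevWeight (F.P K) (K - n) (domainsMeet (cubeDomains (F.P K) a M ρ (K - n) hk) (domainsOfSeq Ω (K - n) hk)) w)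
      {HV : (BondIdx (domainsMeet (cubeDomains (F.P K) a M ρ (K - n) hk) (domainsOfSeq Ω (K - n) hk)) → MatA N) →ₗ[ℂ] (PBond (F.P K) 0 → MatA N)}
      (_ : ∀ (A : BondIdx (domainsMeet (cubeDomains (F.P K) a M ρ (K - n) hk) (domainsOfSeq Ω (K - n) hk)) → MatA N) (b : PBond (F.P K) 0),
        HV A b = ∑ c, ((flatH (F.P K) (K - n) (domainsMeet (cubeDomains (F.P K) a M ρ (K - n) hk) (domainsOfSeq Ω (K - n) hk)) (Pi.single c 1) b : ℝ) : ℂ) • A c)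
      {B : BondIdx (domainsMeet (cubeDomains (F.P K) a M ρ (K - n) hk) (domainsOfSeq Ω (K - n) hk)) → MatA N} {s : ℝ} (_ : 0 ≤ s) (_ : ∀ c, ‖B c‖ ≤ s)
      {t : ℝ} (_ : 2 * C * B₃ * s < t),
      Letters10On (cover (F.P K) '' box (F.P K).L a M (K - n)) ((F.P K).eta (K - n)) t (HV B) := by
  obtain ⟨Mh₀, R₀, C, δ₀, δ₁, B₃, hC, hδ₀, hδ₁, hB₃, hmain⟩ := letters10On_H_uniform_of_core_adm22_T4 F N
  refine ⟨Mh₀, R₀, C, δ₀, δ₁, B₃, hC, hδ₀, hδ₁, hB₃, ?_⟩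
  intro n K hk1 hk' hk Mh R a' hMha hMh hR hsize a M ρ hinj Ω hnest hsat hbox hAdm w hw HV hHv B s hs hB t ht
  exact hmain n K hk1 hk' hMha hMh hR hsize _ (meet_cube_domainsOfSeq_k Ω) hAdm w hw (inOm_top_meet_of_mem_box Ω hinj hk1 hnest hsat hbox) hHv hs hB ht

end Summit.QuantumFields.YangMills.Theorems.K0S5UniformDatumDoor

end
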